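import Mathlib
import Summits.KontsevichZagierPeriods.KontsevichZagierPeriods.Theorems.SoloInformedCubeAnalytic
import Summits.KontsevichZagierPeriods.KontsevichZagierPeriods.Theorems.SoloInformedAyoubLemmaQProof
import HarnessLib
import HarnessLib.Audit

/-!
# SoloInformed — THEOREM P_A in resolution form: the radius-free crux of the Ayoub transfer

The open statement `SoloInformedAyoubPresentation` (THEOREM P_A) asks that every integral
representation be presented, up to a positive multiple and the KZ moves, by cube integrals of real
parts of Ayoub generators (power series algebraic over `ℚ(z)` with radius of convergence `> 1`).
By `soloInformed_cubePresentation_of_analytic` the radius plays no role: it suffices to reach cube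
integrals of functions which are complex-analytic on *some* neighbourhood of `ι([0,1]ᵈ)`, real on
real points and algebraic over `ℚ(z)` (**cube germs**, `SoloInformedCubeGerm`). This file records
the resulting crux

  `SoloInformedAyoubCubeResolution` :  every `r` is KZ-equivalent, up to a positive multiple, to an
  integer combination of cube integrals of cube germs,

proves it *equivalent* to THEOREM P_A (`soloInformed_cubeResolution_iff_presentation`), and
restates the transfer:

  `soloInformed_ayoubTransfer₃ : SoloInformedAyoubCubeResolution → SoloInformedAyoubKZeff →
     KontsevichZagierPeriods`.

What remains open in `SoloInformedAyoubCubeResolution` is a resolution-of-singularities statement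
inside the KZ calculus: semialgebraic triangulation (rule (1)), Nash parametrisation of open
simplices by open cubes, and a tower of algebraic blow-ups / ramified substitutions `t ↦ tᵏ`
(rule (2)) making the pulled-back integrand analytic up to the boundary of the cube; no control of
any radius of convergence is needed any more.

References: J. Ayoub, EMS Newsl. 91 (2014), §2.2, Def. 9–10, Prop. 11; Kontsevich–Zagier 2001,
§1.2 and §4.1; Huber–Müller-Stach, *Periods and Nori motives* (2017), §12.1.
-/

noncomputable section

open scoped BigOperators
open MeasureTheory Set
open Literature.NumberTheory.Transcendental Literature.NumberTheory.Transcendental.KZ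

namespace Summit.KontsevichZagierPeriods.KontsevichZagierPeriods.Theorems

/-! ### Cube germs -/

/-- A **cube germ** in dimension `n`: a function `g : ℂⁿ → ℂ` complex-analytic on an open
neighbourhood `U` of the real unit cube `ι([0,1]ⁿ)`, real on the real points of `U`, and algebraic
over `ℚ(z₁, …, zₙ)` on `U` (`P(z, g z) = 0` for a non-zero `P ∈ ℚ[z, T]`). Ayoub's generators are
the cube germs with `U` a polydisc of radius `> 1`. [Ayoub 2014, Def. 9] -/
structure SoloInformedCubeGerm (n : ℕ) where
  /-- the domain of analyticity -/
  U : Set (Fin n → ℂ)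
  /-- the function -/
  g : (Fin n → ℂ) → ℂ
  /-- `U` is open -/
  isOpen : IsOpen U
  /-- `U` contains the real unit cube -/
  mapsTo : MapsTo (soloInformedToC n) (soloInformedCube n) U
  /-- analyticity on `U` -/
  analytic : AnalyticOnNhd ℂ g U
  /-- `g` is real on the real points of `U` -/
  real : ∀ x : Fin n → ℝ, soloInformedToC n x ∈ U → (g (soloInformedToC n x)).im = 0
  /-- algebraicity over `ℚ(z₁, …, zₙ)` -/
  algebraic : ∃ P : MvPolynomial (Fin (n + 1)) ℚ, P ≠ 0 ∧
    ∀ z ∈ U, MvPolynomial.aeval (Fin.snoc z (g z)) P = 0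

/-- Every Ayoub generator is a cube germ (with `U` its open polydisc). -/
def SoloInformedAyoubGen.toCubeGerm {n : ℕ} (a : SoloInformedAyoubGen n) :
    SoloInformedCubeGerm n where
  U := Metric.ball 0 a.ρ
  g := a.f
  isOpen := Metric.isOpen_ball
  mapsTo x hx := by
    rw [Metric.mem_ball, dist_zero_right]
    refine lt_of_le_of_lt ((pi_norm_le_iff_of_nonneg zero_le_one).2 fun l => ?_) a.one_lt
    rw [soloInformed_mem_cube_iff] at hx
    rw [soloInformedToC_apply, Complex.norm_real, Real.norm_eq_abs, abs_le]
    obtain ⟨h0, h1⟩ := hx l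
    constructor <;> linarith
  analytic := a.analytic
  real := a.real
  algebraic := a.algebraic

/-- The function of the cube germ of an Ayoub generator. -/
@[simp] theorem SoloInformedAyoubGen.toCubeGerm_g {n : ℕ} (a : SoloInformedAyoubGen n) :
    a.toCubeGerm.g = a.f := rfl

/-! ### The crux -/

/-- **THEOREM P_A, resolution form** (the open, radius-free crux of the Ayoub transfer). Every
integral representation `r` of the KZ calculus satisfies

  `k • [r] − ∑ⱼ cⱼ • [ρⱼ] ∈ KZ.relations`

for some integer `k ≠ 0`, integers `cⱼ` and cube representations `ρⱼ = [[0,1]^{dⱼ}, Re gⱼ ∘ ι]`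
whose integrands are (on the cube) real parts of **cube germs** `gⱼ`: functions complex-analytic
on a neighbourhood of `ι([0,1]^{dⱼ})`, real on real points, algebraic over `ℚ(z)`.

Informal content: resolution of singularities *inside the KZ calculus* — semialgebraic
triangulation adapted to the integrand (rule (1)), Nash parametrisation of open simplices by open
cubes and a tower of algebraic blow-ups / ramifications `t ↦ tᵏ` (rule (2)) after which the
pulled-back top form is analytic up to the boundary of the cube (it is Puiseux in the distances to
the faces, with exponents `> −1` by integrability; ramification makes them non-negative integers).
Equivalent to `SoloInformedAyoubPresentation` (`soloInformed_cubeResolution_iff_presentation`).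
[cite: Ayoub2014, Prop. 11] [cite: KontsevichZagier2001, §4.1] -/
@[conjecture] def SoloInformedAyoubCubeResolution : Prop :=
  ∀ (n : ℕ) (r : IntegralRep n), ∃ (k : ℕ) (_ : k ≠ 0) (m : ℕ) (d : Fin m → ℕ)
    (G : ∀ j, SoloInformedCubeGerm (d j)) (c : Fin m → ℤ) (ρ : ∀ j, IntegralRep (d j)),
    (∀ j, (ρ j).domain = soloInformedCube (d j)) ∧
    (∀ j, EqOn (ρ j).integrand (fun x => ((G j).g (soloInformedToC (d j) x)).re)
      (soloInformedCube (d j))) ∧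
    k • of r - ∑ j, c j • of (ρ j) ∈ relations

/-! ### Resolution form ⇔ THEOREM P_A -/

/-- A cube integral of (the real part of) a cube germ is presented, modulo the KZ moves, by cube
integrals of real parts of Ayoub generators. -/
theorem soloInformed_cubePresentation_of_germ {n : ℕ} (G : SoloInformedCubeGerm n)
    (r : IntegralRep n) (hr : r.domain = soloInformedCube n)
    (hri : EqOn r.integrand (fun x => (G.g (soloInformedToC n x)).re) (soloInformedCube n)) :
    ∃ (m : ℕ) (a : Fin m → SoloInformedAyoubGen n) (ρ : Fin m → IntegralRep n),
      (∀ i, (ρ i).domain = soloInformedCube n) ∧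
      (∀ i, EqOn (ρ i).integrand (fun x => ((a i).f (soloInformedToC n x)).re)
        (soloInformedCube n)) ∧
      of r - ∑ i, of (ρ i) ∈ relations := by
  obtain ⟨P, hP, hPg⟩ := G.algebraic
  exact soloInformed_cubePresentation_of_analytic G.isOpen G.mapsTo G.analytic G.real hP hPg r
    hr hri

/-! ### Examples of cube germs: polynomials and pole-free rational functions over `ℚ` -/

/-- A polynomial over `ℚ` in the variables and `T` which is not the zero polynomial because it takes
different values at two points. -/
theorem soloInformed_mvPolynomial_ne_zero_of_aeval_ne {m : ℕ} {P : MvPolynomial (Fin m) ℚ}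
    {v w : Fin m → ℂ} (h : MvPolynomial.aeval v P ≠ MvPolynomial.aeval w P) : P ≠ 0 := by
  rintro rfl
  exact h (by simp)

/-- The polynomial `q(z) T − p(z) ∈ ℚ[z, T]` is non-zero as soon as `q` does not vanish at some
point. -/
theorem soloInformed_linearPoly_ne_zero {n : ℕ} (p q : MvPolynomial (Fin n) ℚ) {z : Fin n → ℂ}
    (hz : MvPolynomial.aeval z q ≠ 0) :
    MvPolynomial.X (Fin.last n) * MvPolynomial.rename Fin.castSucc q -
      MvPolynomial.rename Fin.castSucc p ≠ 0 := by
  refine soloInformed_mvPolynomial_ne_zero_of_aeval_ne (v := Fin.snoc z 1) (w := Fin.snoc z 0) ?_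
  have hc : ∀ t : ℂ, (fun i => Fin.snoc (α := fun _ => ℂ) z t (Fin.castSucc i)) = z :=
    fun t => funext fun i => by simp
  simp only [map_sub, map_mul, MvPolynomial.aeval_X, Fin.snoc_last, MvPolynomial.aeval_rename,
    Function.comp_def, hc, one_mul, zero_mul, zero_sub]
  intro h
  exact hz (by linear_combination h)

/-- `ℚ`-polynomials evaluated on `ℂⁿ` are evaluations of their images in `ℂ[z]`. -/
theorem soloInformed_aeval_eq_eval_map {n : ℕ} (q : MvPolynomial (Fin n) ℚ) (z : Fin n → ℂ) :
    MvPolynomial.aeval z q = MvPolynomial.eval z (MvPolynomial.map (algebraMap ℚ ℂ) q) := by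
  rw [MvPolynomial.eval_map, MvPolynomial.aeval_def]

/-- `ℚ`-polynomial functions are analytic on `ℂⁿ`. -/
theorem soloInformed_analyticOnNhd_aeval {n : ℕ} (q : MvPolynomial (Fin n) ℚ) :
    AnalyticOnNhd ℂ (fun z : Fin n → ℂ => MvPolynomial.aeval z q) Set.univ := by
  have h : (fun z : Fin n → ℂ => MvPolynomial.aeval z q) =
      fun z => MvPolynomial.eval z (MvPolynomial.map (algebraMap ℚ ℂ) q) :=
    funext fun z => soloInformed_aeval_eq_eval_map q z
  rw [h]
  exact AnalyticOnNhd.eval_mvPolynomial _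

/-- **Rational cube germ.** For `p, q ∈ ℚ[z₁, …, zₙ]` with `q` non-vanishing on the real unit cube,
`p/q` is a cube germ on `U = {q ≠ 0}`, with `P = q(z) T − p(z)`. -/
def soloInformedRationalGerm {n : ℕ} (p q : MvPolynomial (Fin n) ℚ)
    (hq : ∀ x ∈ soloInformedCube n, MvPolynomial.aeval (soloInformedToC n x) q ≠ 0) :
    SoloInformedCubeGerm n where
  U := {z | MvPolynomial.aeval z q ≠ 0}
  g z := MvPolynomial.aeval z p / MvPolynomial.aeval z q
  isOpen := isOpen_ne_fun (soloInformed_analyticOnNhd_aeval q).continuous continuous_const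
  mapsTo x hx := hq x hx
  analytic z hz :=
    ((soloInformed_analyticOnNhd_aeval p) z trivial).div
      ((soloInformed_analyticOnNhd_aeval q) z trivial) hz
  real x _ := by
    have hp := soloInformed_ofReal_aeval x p
    have hq' := soloInformed_ofReal_aeval x q
    simp only [← soloInformedToC_apply] at hp hq'
    rw [← hp, ← hq', ← Complex.ofReal_div, Complex.ofReal_im]
  algebraic := by
    refine ⟨MvPolynomial.X (Fin.last n) * MvPolynomial.rename Fin.castSucc q -
      MvPolynomial.rename Fin.castSucc p,
      soloInformed_linearPoly_ne_zero p q (hq 0 (by simp [soloInformed_mem_cube_iff])),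
      fun z hz => ?_⟩
    have hc : (fun i => Fin.snoc (α := fun _ => ℂ) z
        (MvPolynomial.aeval z p / MvPolynomial.aeval z q) (Fin.castSucc i)) = z :=
      funext fun i => by simp
    simp only [map_sub, map_mul, MvPolynomial.aeval_X, Fin.snoc_last, MvPolynomial.aeval_rename,
      Function.comp_def, hc]
    rw [div_mul_cancel₀ _ (by exact hz), sub_self]

/-- **Polynomial cube germ**: `p ∈ ℚ[z₁, …, zₙ]` (the rational germ `p/1`). -/
def soloInformedPolynomialGerm {n : ℕ} (p : MvPolynomial (Fin n) ℚ) : SoloInformedCubeGerm n :=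
  soloInformedRationalGerm p 1 fun _ _ => by simp

/-- **Rung (non-vacuity of the pipeline).** A cube integral `[[0,1]ⁿ, p/q]` of a rational
function with rational coefficients whose denominator does not vanish on the (complexified) cube
is presented, modulo the KZ moves, by cube integrals of real parts of Ayoub generators — by grid
subdivision and rescaling alone, no resolution of singularities being needed.
[Ayoub 2014, Def. 9–10] -/
theorem soloInformed_presentation_rung_rational {n : ℕ} (p q : MvPolynomial (Fin n) ℚ)
    (hq : ∀ x ∈ soloInformedCube n, MvPolynomial.aeval (soloInformedToC n x) q ≠ 0)
    (r : IntegralRep n) (hr : r.domain = soloInformedCube n)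
    (hri : EqOn r.integrand (fun x => MvPolynomial.aeval x p / MvPolynomial.aeval x q)
      (soloInformedCube n)) :
    ∃ (m : ℕ) (a : Fin m → SoloInformedAyoubGen n) (ρ : Fin m → IntegralRep n),
      (∀ i, (ρ i).domain = soloInformedCube n) ∧
      (∀ i, EqOn (ρ i).integrand (fun x => ((a i).f (soloInformedToC n x)).re)
        (soloInformedCube n)) ∧
      of r - ∑ i, of (ρ i) ∈ relations := by
  refine soloInformed_cubePresentation_of_germ (soloInformedRationalGerm p q hq) r hr fun x hx => ?_
  rw [hri hx]
  show _ = (MvPolynomial.aeval (soloInformedToC n x) p /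
    MvPolynomial.aeval (soloInformedToC n x) q).re
  have hp := soloInformed_ofReal_aeval x p
  have hq' := soloInformed_ofReal_aeval x q
  simp only [← soloInformedToC_apply] at hp hq'
  rw [← hp, ← hq', ← Complex.ofReal_div, Complex.ofReal_re]

/-- **Resolution form ⇒ THEOREM P_A**: flatten the two-level presentation. -/
theorem soloInformed_presentation_of_cubeResolution (h : SoloInformedAyoubCubeResolution) :
    SoloInformedAyoubPresentation := by
  intro n r
  obtain ⟨k, hk, m, d, G, c, ρ, hd, hI, hrel⟩ := h n r
  choose mj aj ρj hdj hIj hrelj using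
    fun j => soloInformed_cubePresentation_of_germ (G j) (ρ j) (hd j) (hI j)
  let σ : Fin (∑ j, mj j) ≃ (Σ j : Fin m, Fin (mj j)) := finSigmaFinEquiv.symm
  refine ⟨k, hk, ∑ j, mj j, fun i => d (σ i).1, fun i => aj (σ i).1 (σ i).2, fun i => c (σ i).1,
    fun i => ρj (σ i).1 (σ i).2, fun i => hdj _ _, fun i => hIj _ _, ?_⟩
  have hsum : ∑ i, c (σ i).1 • of (ρj (σ i).1 (σ i).2) =
      ∑ j, c j • ∑ i, of (ρj j i) := by
    rw [σ.sum_comp (fun p : Σ j : Fin m, Fin (mj j) => c p.1 • of (ρj p.1 p.2)),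
      Fintype.sum_sigma]
    exact Finset.sum_congr rfl fun j _ => by
      dsimp only
      rw [Finset.smul_sum]
  rw [hsum, show k • of r - ∑ j, c j • ∑ i, of (ρj j i) =
    (k • of r - ∑ j, c j • of (ρ j)) + ∑ j, c j • (of (ρ j) - ∑ i, of (ρj j i)) by
      simp only [smul_sub, Finset.sum_sub_distrib]; abel]
  exact relations.add_mem hrel (relations.sum_mem fun j _ => relations.zsmul_mem (hrelj j) _)

/-- **THEOREM P_A ⇒ resolution form**: Ayoub generators are cube germs. -/
theorem soloInformed_cubeResolution_of_presentation (h : SoloInformedAyoubPresentation) :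
    SoloInformedAyoubCubeResolution := by
  intro n r
  obtain ⟨k, hk, m, d, a, c, ρ, hd, hI, hrel⟩ := h n r
  exact ⟨k, hk, m, d, fun j => (a j).toCubeGerm, c, ρ, hd, hI, hrel⟩

/-- The resolution form is equivalent to THEOREM P_A. -/
theorem soloInformed_cubeResolution_iff_presentation :
    SoloInformedAyoubCubeResolution ↔ SoloInformedAyoubPresentation :=
  ⟨soloInformed_presentation_of_cubeResolution, soloInformed_cubeResolution_of_presentation⟩

/-! ### The transfer, radius-free -/

/-- **The Ayoub transfer with the radius-free crux.** The Kontsevich–Zagier period conjecture in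
the KZ-calculus form follows from the resolution statement `SoloInformedAyoubCubeResolution` and
Ayoub's (real, effective) form of the period conjecture `SoloInformedAyoubKZeff`; LEMMA Q and the
reduction of the radius condition are proved. [Ayoub 2014, Rem. 13] -/
theorem soloInformed_ayoubTransfer₃ (hR : SoloInformedAyoubCubeResolution)
    (hA : SoloInformedAyoubKZeff) : KontsevichZagierPeriods :=
  soloInformed_ayoubTransfer₂ (soloInformed_presentation_of_cubeResolution hR) hA

/-! ### Ayoub's conjecture up to torsion (the faithful `ℚ`-linear consequence) -/

/-- **Ayoub's conjecture, effective real form, UP TO TORSION**: a formal `ℤ`-combination of real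
generators with integral `0` has a non-zero multiple in the relation module `⟨(E),(A),(I),(S)⟩`.
This is the faithful consequence, for our `ℤ`-typed symbols, of injectivity of Ayoub's `ℚ`-LINEAR
evaluation `Ev : 𝒫^eff → ℂ` ([Ayoub 2014, Rem. 13]: `𝒫^eff` is a quotient of the `ℚ`-vector space
`𝒪_alg(𝔻^∞)`): the map `θ : [a] ↦ a.f` to `𝒪_alg(𝔻^∞)` kills exactly `⟨(E),(A),(I)⟩` (sums and
dummy extensions of generators are generators) and sends the (S)-instances onto the Stokes
elements, so `Ev x = 0 ⇒ θ x ∈ ℚ·Stokes ⇒ N θ x ∈ θ⟨(S)⟩ ⇒ N x ∈ Rel`. OPEN; used only as a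
hypothesis. Implied by `SoloInformedAyoubKZeff` (`N = 1`). [cite: Ayoub2014, Conj. 7, Rem. 13] -/
@[conjecture] def SoloInformedAyoubKZeffQ : Prop :=
  ∀ x : SoloInformedAyoubSymbols, soloInformedAyoubEv x = 0 →
    ∃ N : ℕ, N ≠ 0 ∧ N • x ∈ soloInformedAyoubRel

/-- The torsion-free form implies the form up to torsion. -/
theorem soloInformed_ayoubKZeffQ_of_KZeff (h : SoloInformedAyoubKZeff) :
    SoloInformedAyoubKZeffQ :=
  fun x hx => ⟨1, one_ne_zero, by simpa using h x hx⟩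

/-- A scalar identity in additive commutative groups used to clear the three multiples. -/
theorem soloInformed_smul_identity {G : Type*} [AddCommGroup G] (a b u v : G) (N k k' : ℕ) :
    (N * (k * k')) • (u - v) =
      N • (k' • a - k • b) - (N * k') • (a - k • u) + (N * k) • (b - k' • v) := by
  module

/-- **THEOREM D_A up to torsion**: LEMMA Q, THEOREM P_A and Ayoub's conjecture in the form up to
torsion imply the Kontsevich–Zagier period conjecture — FACT M (`KZ.relations` is saturated in the
free abelian group) absorbs the extra multiple `N`. -/
theorem soloInformed_ayoubTransferQ (hQ : SoloInformedAyoubLemmaQ)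
    (hP : SoloInformedAyoubPresentation) (hA : SoloInformedAyoubKZeffQ) :
    KontsevichZagierPeriods := by
  refine KontsevichZagierPeriods_iff.2 fun n n' r r' _ _ hv => ?_
  obtain ⟨k, hk, m, d, a, c, ρ, hρd, hρi, hrel⟩ := hP n r
  obtain ⟨k', hk', m', d', a', c', ρ', hρd', hρi', hrel'⟩ := hP n' r'
  set x : SoloInformedAyoubSymbols := ∑ j, c j • soloInformedAyoubOf (a j) with hx
  set x' : SoloInformedAyoubSymbols := ∑ j, c' j • soloInformedAyoubOf (a' j) with hx'
  have hψ : soloInformedAyoubPsi hQ x - k • of r ∈ relations :=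
    soloInformedAyoubPsi_presentation hQ r a c ρ hρd hρi hrel
  have hψ' : soloInformedAyoubPsi hQ x' - k' • of r' ∈ relations :=
    soloInformedAyoubPsi_presentation hQ r' a' c' ρ' hρd' hρi' hrel'
  have hre := soloInformedAyoubEv_re_eq hQ r k x hψ
  have hre' := soloInformedAyoubEv_re_eq hQ r' k' x' hψ'
  have him : (soloInformedAyoubEv x).im = 0 := soloInformedAyoubEv_sum_im hQ a c
  have him' : (soloInformedAyoubEv x').im = 0 := soloInformedAyoubEv_sum_im hQ a' c'
  have hy : soloInformedAyoubEv (k' • x - k • x') = 0 := by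
    apply Complex.ext
    · rw [map_sub, map_nsmul, map_nsmul, nsmul_eq_mul, nsmul_eq_mul, Complex.sub_re,
        Complex.mul_re, Complex.mul_re, hre, hre', him, him', hv]
      simp only [Complex.natCast_re, Complex.natCast_im, zero_mul, sub_zero, Complex.zero_re]
      ring
    · rw [map_sub, map_nsmul, map_nsmul, nsmul_eq_mul, nsmul_eq_mul, Complex.sub_im,
        Complex.mul_im, Complex.mul_im, hre, hre', him, him']
      simp
  -- Ayoub's conjecture up to torsion: `N • y` is an Ayoub relation for some `N ≠ 0`
  obtain ⟨N, hN, hNy⟩ := hA _ hy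
  have hΨy : soloInformedAyoubPsi hQ (N • (k' • x - k • x')) ∈ relations :=
    soloInformedAyoubPsi_rel hQ hNy
  have e2 : soloInformedAyoubPsi hQ (N • (k' • x - k • x')) =
      N • (k' • soloInformedAyoubPsi hQ x - k • soloInformedAyoubPsi hQ x') := by
    simp only [map_nsmul, map_sub]
  have hkk : (N * (k * k')) • (of r - of r') ∈ relations := by
    rw [soloInformed_smul_identity (soloInformedAyoubPsi hQ x) (soloInformedAyoubPsi hQ x')
      (of r) (of r') N k k', ← e2]
    exact relations.add_mem (relations.sub_mem hΨy (relations.nsmul_mem hψ _))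
      (relations.nsmul_mem hψ' _)
  exact soloInformed_equivalent_of_nsmul_sub_mem (mul_ne_zero hN (mul_ne_zero hk hk')) hkk

/-- **THEOREM D_A, final form of this file**: the radius-free resolution statement and Ayoub's
conjecture up to torsion imply the Kontsevich–Zagier period conjecture. -/
theorem soloInformed_ayoubTransfer₄ (hR : SoloInformedAyoubCubeResolution)
    (hA : SoloInformedAyoubKZeffQ) : KontsevichZagierPeriods :=
  soloInformed_ayoubTransferQ soloInformed_ayoubLemmaQ
    (soloInformed_presentation_of_cubeResolution hR) hA

end Summit.KontsevichZagierPeriods.KontsevichZagierPeriods.Theorems
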